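import Summits.KontsevichZagierPeriods.KontsevichZagierPeriods.Theses.TerasomaMultiplication
import Summits.KontsevichZagierPeriods.KontsevichZagierPeriods.Theorems.CompleteModGammaSector.Negative.LoadBearing
import Literature.NumberTheory.Transcendental.KZRulesAssociator
import Literature.NumberTheory.Transcendental.KZRelationsLE
import Literature.NumberTheory.Transcendental.KZSubcalculusInvariants
import Literature.NumberTheory.Transcendental.KZLogCalculusProofs
import Literature.NumberTheory.Transcendental.KZCalculusProofs
-- (re-add when built on the farm) import Summits.KontsevichZagierPeriods.KontsevichZagierPeriods.Theorems.TerasomaMultiplicationCompleteModGammaSectorStubFuchsianTransport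
-- (re-add when built on the farm) import Summits.KontsevichZagierPeriods.KontsevichZagierPeriods.Theorems.TerasomaMultiplicationCompleteModGammaSectorStubTorsionFreeModGamma
-- (re-add when built on the farm) import Summits.KontsevichZagierPeriods.KontsevichZagierPeriods.Theorems.TerasomaMultiplicationCompleteModGammaSectorStubOrderOneTransport
-- (re-add when built on the farm) import Summits.KontsevichZagierPeriods.KontsevichZagierPeriods.Theorems.TerasomaMultiplicationCompleteModGammaSectorStubSpectatorStabilityCubes

/-!
# `CompleteModGammaSector` (stmt-KontsevichZagierPeriods-14233) — line `Sketch` (card wronskian-transport)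

Crux proof SKELETON of the line lead (attempt 0). The crux (Conjecture 1 of Kontsevich–Zagier for
the Γ-enlarged calculus: every rational equal-value difference lies in every subgroup
`H ≥ relations` containing the Deligne–Koblitz–Ogus Γ-Hodge pair differences; kernel form
`ker eval ≤ sector`, `CompleteModGammaSectorNegative.completeModGammaSector_iff_ker_le`) is
reduced to REGISTERED STUBS along the card `Ideas/wronskian-transport.md` (variation of constants
inside the rules; modulo Γ the two tolls of Fuchsian transport are the anchors — Γ-pairs — and the
Wronskian — a Beta product, cancelled by π-cancellation):

* `stub_orderOneTransport` — the ENGINE, analytic half: one Newton–Leibniz move in the PARAMETER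
  transports a fibre class along a band whose total class is a relation (provable now; used by the
  instances of the residual, not by the composition);
* `stub_fuchsianTransport` — the ENGINE, algebraic half, in the formal period ring
  `P = FormalRep ⧸ relations`: Cramer elimination with a period basis + Wronskian/π bookkeeping,
  CONDITIONAL on the two seams it names as hypotheses (provable now: commutative algebra);
* `stub_torsionFreeModGamma` — seam 1: `P ⧸ JΓ` is torsion-free (provable now: `P ∋ ⟦[pt,1/k]⟧`);
* `stub_piCancellationModGamma` — seam 2: `⟦[π]⟧` is a non-zero-divisor modulo the Γ-ideal `JΓ`
  (open; crux-implied; [π]-strength, cf. `KZ.PiCancellation` stmt-0540);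
* `stub_spectatorStability` — seam 3 (generator form, reshaped from the cycle-1 stub
  `stub_idealGap`, which is now the derived theorem `idealGap`): `sector` absorbs spectator
  products `[σ] · (Γ-pair)` (open; crux-implied; = `SubgroupSeam` of card domain-mod-gamma);
* `stub_spectatorStabilityCubes` — its Beta-cube case (LANDED p90520; not used by the composition);
* `stub_anchoredTransportData` — the RESIDUAL (GPC-strength, honest remainder of the line): every
  value-zero formal combination is the endpoint fibre of anchored order-two transport data with a
  `π`-proportional Wronskian (instances: Legendre/Elliott families, AAR Thm 3.2.7–3.2.8; produced
  from bands by `stub_orderOneTransport`);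

composed in `CompleteModGammaSector_of`. Here `JΓ := Ideal.span (toFormalPeriod '' gammaHodgePairs)`
is the Γ-ideal of `P` (written out in every signature; no definition is introduced in this file) and
`sector = relations ⊔ closure gammaHodgePairs` is the landed vocabulary of
`Theorems/CompleteModGammaSector/Negative/LoadBearing.lean`.

Sorry-free content of this file: `span_gammaHodgePairs_le_ker_evalP` (`JΓ ≤ ker evalP`),
`toFormalPeriod_mem_span_of_mem_sector` (`sector` maps into `JΓ`), and the CRUX-IMPLICATION of
every open stub (`piCancellationModGamma_of_crux`, `idealGap_of_crux`,
`anchoredTransportData_of_crux`): no stub is refutable short of `¬ KontsevichZagierPeriods`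
(`CompleteModGammaSectorNegative.summit_false_of_not`).

References: Kontsevich–Zagier 2001 §1.2, §4.1; Andrews–Askey–Roy 1999 Lemma 3.2.6, Thm 3.2.7,
Thm 3.2.8 (Legendre/Elliott as Wronskians); Huber–Wüstholz 2022 App. A (effective injectivity).
-/

noncomputable section

-- `Summit.KontsevichZagierPeriods.KontsevichZagierPeriods.…` is the tree's mandated layout (single-conjunct summit).
set_option linter.dupNamespace false

namespace Summit.KontsevichZagierPeriods.KontsevichZagierPeriods.CompleteModGammaSectorLine

open MeasureTheory Set
open Literature.NumberTheory.Transcendental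
open Literature.NumberTheory.Transcendental.KZ
open Summit.KontsevichZagierPeriods.KontsevichZagierPeriods.Theses.TerasomaMultiplication
  (CompleteModGammaSector)
open Summit.KontsevichZagierPeriods.CompleteModGammaSectorNegative
  (gammaHodgePairs sector completeModGammaSector_iff_ker_le closure_gammaHodgePairs_le_ker_eval
    sector_le_ker_eval)

/-! ## Registered stubs

LANDED (imported above, same namespace, exact registered signatures):
`stub_fuchsianTransport` (p87891, `…StubFuchsianTransport.lean`), `stub_torsionFreeModGamma` (p88705,
`…StubTorsionFreeModGamma.lean`), `stub_orderOneTransport` (p89176, `…StubOrderOneTransport.lean`),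
`stub_spectatorStabilityCubes` (p90520, `…StubSpectatorStabilityCubes.lean`: Beta-cube spectators are
absorbed by the sector — the provable case of seam 3).
OPEN below: the two seams and the residual. -/

/-! ### Landed stubs (restated, see docstrings) -/

/-- LANDED p89176 (`Theorems/TerasomaMultiplicationCompleteModGammaSectorStubOrderOneTransport.lean`):
engine, analytic half — one Newton–Leibniz move in the parameter (restated with `sorry` only until the
farm builds the module). [cite: KontsevichZagier2001, §1.2 rule (3)] -/
theorem stub_orderOneTransport :
    ∀ (n : ℕ) (q₀ q₁ : ℚ) (F : (Fin (n + 1) → ℝ) → ℝ)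
      (r : IntegralRep (n + 1)) (r₀ r₁ : IntegralRep n),
      q₀ ≤ q₁ →
      r₀.domain = r₁.domain →
      r.domain = {z | (Fin.init z : Fin n → ℝ) ∈ r₁.domain ∧ ((q₀ : ℚ) : ℝ) ≤ z (Fin.last n) ∧
        z (Fin.last n) ≤ ((q₁ : ℚ) : ℝ)} →
      IsSemialgebraicFunOn ℚ r.domain F →
      (∀ x ∈ r₁.domain, ContinuousOn (fun t : ℝ => F (Fin.snoc x t)) (Set.Icc ((q₀ : ℚ) : ℝ) q₁)) →
      (∀ x ∈ r₁.domain, ∀ t ∈ Set.Ioo ((q₀ : ℚ) : ℝ) q₁,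
        HasDerivAt (fun s : ℝ => F (Fin.snoc x s)) (r.integrand (Fin.snoc x t)) t) →
      Set.EqOn r₀.integrand (fun x => F (Fin.snoc x q₀)) r₀.domain →
      Set.EqOn r₁.integrand (fun x => F (Fin.snoc x q₁)) r₁.domain →
      of r ∈ relations →
      of r₁ - of r₀ ∈ relations := by
  sorry

/-- LANDED p87891 (`Theorems/TerasomaMultiplicationCompleteModGammaSectorStubFuchsianTransport.lean`):
engine, algebraic half — Cramer elimination + Wronskian/π bookkeeping in `P` (restated with `sorry`
only until the farm builds the module). [cite: AndrewsAskeyRoy1999, Lemma 3.2.6] -/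
theorem stub_fuchsianTransport :
    ∀ (F₀ F₀' F₁ F₁' K₁₀ K₁₀' K₂₀ K₂₀' K₁₁ K₁₁' K₂₁ K₂₁' : FormalPeriodRing) (m a b p q : ℤ),
      (∀ x : FormalPeriodRing, toFormalPeriod (of piRep) * x ∈ Ideal.span (toFormalPeriod '' gammaHodgePairs) →
        x ∈ Ideal.span (toFormalPeriod '' gammaHodgePairs)) →
      (∀ (k : ℤ) (x : FormalPeriodRing), k ≠ 0 → k • x ∈ Ideal.span (toFormalPeriod '' gammaHodgePairs) →
        x ∈ Ideal.span (toFormalPeriod '' gammaHodgePairs)) →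
      m ≠ 0 → q ≠ 0 →
      F₀ ∈ Ideal.span (toFormalPeriod '' gammaHodgePairs) →
      F₀' ∈ Ideal.span (toFormalPeriod '' gammaHodgePairs) →
      m • (F₁ * K₂₁' - F₁' * K₂₁) - a • (F₀ * K₂₀' - F₀' * K₂₀) = 0 →
      m • (F₁ * K₁₁' - F₁' * K₁₁) - b • (F₀ * K₁₀' - F₀' * K₁₀) = 0 →
      p • (K₁₁ * K₂₁' - K₂₁ * K₁₁') - q • toFormalPeriod (of piRep) ∈
        Ideal.span (toFormalPeriod '' gammaHodgePairs) →
      F₁ ∈ Ideal.span (toFormalPeriod '' gammaHodgePairs) := by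
  sorry

/-- LANDED p88705 (`Theorems/TerasomaMultiplicationCompleteModGammaSectorStubTorsionFreeModGamma.lean`):
seam 1 — `P ⧸ JΓ` is torsion-free (restated with `sorry` only until the farm builds the module).
[cite: KontsevichZagier2001, §1.2 rule (1)] -/
theorem stub_torsionFreeModGamma :
    ∀ (k : ℤ) (x : FormalPeriodRing), k ≠ 0 → k • x ∈ Ideal.span (toFormalPeriod '' gammaHodgePairs) →
      x ∈ Ideal.span (toFormalPeriod '' gammaHodgePairs) := by
  sorry

/-- LANDED p90520 (`Theorems/TerasomaMultiplicationCompleteModGammaSectorStubSpectatorStabilityCubes.lean`):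
Beta-cube spectators are absorbed by the sector (restated with `sorry` only until the farm builds the
module). [cite: Deligne1982HodgeCycles, Thm. 7.18] -/
theorem stub_spectatorStabilityCubes :
    ∀ (M : ℕ) (a b : Fin M → ℚ) (s : IntegralRep M),
      Summit.KontsevichZagierPeriods.GammaHodgeSectorNegative.Admissible a b →
      Summit.KontsevichZagierPeriods.GammaHodgeSectorNegative.IsCubeBetaRep a b s →
      ∀ d : FormalRep, d ∈ gammaHodgePairs → of s * d ∈ sector := by
  sorry

/-! ### Open stubs -/

/-- STUB (seam 2, card `PiCancellationModGamma`; OPEN, crux-implied, `[π]`-strength): the class of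
`[disc, 1]` is a non-zero-divisor modulo the Γ-ideal. [cite: HuberWustholz2022, App. A] -/
theorem stub_piCancellationModGamma :
    ∀ x : FormalPeriodRing, toFormalPeriod (of piRep) * x ∈ Ideal.span (toFormalPeriod '' gammaHodgePairs) →
      x ∈ Ideal.span (toFormalPeriod '' gammaHodgePairs) := by
  sorry

/-- STUB (seam 3 in GENERATOR FORM, reshaped cycle 1→2: `SpectatorStability` of card
spectator-stability-split / `IdealGap` of card wronskian-transport / `SubgroupSeam` of card
domain-mod-gamma; OPEN, crux-implied): the Γ-subgroup `sector` absorbs the Fubini product of ANY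
single representation (the spectator) with a Γ-pair difference. Equivalent to the ideal-preimage
form `∀ c, ⟦c⟧ ∈ JΓ → c ∈ sector` (`idealGap`, `spectatorStability_of_idealGap` below); open already
for the 0-dimensional spectator `[pt, 1/2]`. [cite: KontsevichZagier2001, §4.1] -/
theorem stub_spectatorStability :
    ∀ (n : ℕ) (σ : IntegralRep n) (d : FormalRep), d ∈ gammaHodgePairs → of σ * d ∈ sector := by
  sorry

/-- STUB (RESIDUAL of the line, card `AnchoredDeformability`; OPEN, GPC-strength, crux-implied):
every value-zero formal combination `c` is the endpoint fibre `F₁ = ⟦c⟧` of ANCHORED ORDER-TWO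
TRANSPORT DATA — anchors `F₀, F₀'` in the Γ-ideal, transported first integrals against a period
basis `K`, and a Wronskian congruent to a non-zero rational multiple of `⟦π⟧` modulo `JΓ` — i.e.
exactly the hypotheses of `stub_fuchsianTransport`. Instances are produced from anchored holonomic
families by `stub_orderOneTransport` (Legendre/Elliott: AAR Thm 3.2.7–3.2.8); the ∀ is the open
content of the crux in transport form. [cite: AndrewsAskeyRoy1999, Thm 3.2.8] -/
theorem stub_anchoredTransportData :
    ∀ c : FormalRep, eval c = 0 →
      ∃ (F₀ F₀' F₁' K₁₀ K₁₀' K₂₀ K₂₀' K₁₁ K₁₁' K₂₁ K₂₁' : FormalPeriodRing) (m a b p q : ℤ),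
        m ≠ 0 ∧ q ≠ 0 ∧
        F₀ ∈ Ideal.span (toFormalPeriod '' gammaHodgePairs) ∧
        F₀' ∈ Ideal.span (toFormalPeriod '' gammaHodgePairs) ∧
        m • (toFormalPeriod c * K₂₁' - F₁' * K₂₁) - a • (F₀ * K₂₀' - F₀' * K₂₀) = 0 ∧
        m • (toFormalPeriod c * K₁₁' - F₁' * K₁₁) - b • (F₀ * K₁₀' - F₀' * K₁₀) = 0 ∧
        p • (K₁₁ * K₂₁' - K₂₁ * K₁₁') - q • toFormalPeriod (of piRep) ∈
          Ideal.span (toFormalPeriod '' gammaHodgePairs) := by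
  sorry

/-! ## Glue for seam 3 (sorry-free): spectator stability ⟺ ideal gap -/

/-- If `sector` absorbs spectator products with Γ-pairs, then `sector` is a left ideal of
`FormalRep` (the `relations` summand is an ideal: `KZ.mul_mem_relations_left_holds`). [folklore] -/
theorem mul_mem_sector_of_spectator
    (H : ∀ (n : ℕ) (σ : IntegralRep n) (d : FormalRep), d ∈ gammaHodgePairs → of σ * d ∈ sector)
    (b e : FormalRep) (he : e ∈ sector) : b * e ∈ sector := by
  have hgen : ∀ (b d : FormalRep), d ∈ gammaHodgePairs → b * d ∈ sector := by
    intro b d hd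
    induction b using FreeAbelianGroup.induction_on with
    | zero => rw [zero_mul]; exact AddSubgroup.zero_mem _
    | of X => obtain ⟨n, σ⟩ := X; exact H n σ d hd
    | neg X ih => rw [neg_mul]; exact AddSubgroup.neg_mem _ ih
    | add X Y hX hY => rw [add_mul]; exact AddSubgroup.add_mem _ hX hY
  have he' : e ∈ relations ⊔ AddSubgroup.closure gammaHodgePairs := he
  obtain ⟨r, hr, g, hg, rfl⟩ := AddSubgroup.mem_sup.mp he'
  rw [mul_add]
  refine AddSubgroup.add_mem _
    (AddSubgroup.mem_sup_left (mul_mem_relations_left_holds r b hr)) ?_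
  refine AddSubgroup.closure_induction (p := fun g _ => b * g ∈ sector) ?_ ?_ ?_ ?_ hg
  · intro d hd; exact hgen b d hd
  · rw [mul_zero]; exact AddSubgroup.zero_mem _
  · intro x y _ _ hx hy; rw [mul_add]; exact AddSubgroup.add_mem _ hx hy
  · intro x _ hx; rw [mul_neg]; exact AddSubgroup.neg_mem _ hx

/-- Spectator stability implies the ideal-preimage form of the seam (`Submodule.span_induction`).
[folklore] -/
theorem idealGap_of_spectator
    (H : ∀ (n : ℕ) (σ : IntegralRep n) (d : FormalRep), d ∈ gammaHodgePairs → of σ * d ∈ sector) :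
    ∀ c : FormalRep, toFormalPeriod c ∈ Ideal.span (toFormalPeriod '' gammaHodgePairs) → c ∈ sector := by
  intro c hc
  suffices h : ∀ p ∈ Ideal.span (toFormalPeriod '' gammaHodgePairs), ∀ c : FormalRep,
      toFormalPeriod c = p → c ∈ sector from h _ hc c rfl
  intro p hp
  refine Submodule.span_induction (p := fun p _ => ∀ c : FormalRep, toFormalPeriod c = p → c ∈ sector)
    ?_ ?_ ?_ ?_ hp
  · rintro _ ⟨d, hd, rfl⟩ c hcd
    have h1 : c - d ∈ sector := AddSubgroup.mem_sup_left (toFormalPeriod_eq_iff.mp hcd)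
    have h2 : d ∈ sector := AddSubgroup.mem_sup_right (AddSubgroup.subset_closure hd)
    simpa using AddSubgroup.add_mem _ h1 h2
  · intro c hc0
    exact AddSubgroup.mem_sup_left (toFormalPeriod_eq_zero_iff.mp hc0)
  · intro x y _ _ hx hy c hcxy
    obtain ⟨a, rfl⟩ := toFormalPeriod_surjective x
    obtain ⟨b, rfl⟩ := toFormalPeriod_surjective y
    have ha := hx a rfl
    have hb := hy b rfl
    rw [← map_add, toFormalPeriod_eq_iff] at hcxy
    have h3 : c - (a + b) ∈ sector := AddSubgroup.mem_sup_left hcxy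
    simpa using AddSubgroup.add_mem _ h3 (AddSubgroup.add_mem _ ha hb)
  · intro a x _ hx c hcax
    obtain ⟨b, rfl⟩ := toFormalPeriod_surjective a
    obtain ⟨e, rfl⟩ := toFormalPeriod_surjective x
    have he := hx e rfl
    rw [smul_eq_mul, ← map_mul, toFormalPeriod_eq_iff] at hcax
    have h3 : c - b * e ∈ sector := AddSubgroup.mem_sup_left hcax
    simpa using AddSubgroup.add_mem _ h3 (mul_mem_sector_of_spectator H b e he)

/-- Conversely the ideal-preimage form gives spectator stability (so the reshaped stub is EXACTLY
the old seam `IdealGap`). [folklore] -/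
theorem spectatorStability_of_idealGap
    (h : ∀ c : FormalRep, toFormalPeriod c ∈ Ideal.span (toFormalPeriod '' gammaHodgePairs) → c ∈ sector) :
    ∀ (n : ℕ) (σ : IntegralRep n) (d : FormalRep), d ∈ gammaHodgePairs → of σ * d ∈ sector := by
  intro n σ d hd
  refine h _ ?_
  rw [map_mul]
  exact Ideal.mul_mem_left _ _ (Ideal.subset_span ⟨d, hd, rfl⟩)

/-- **Seam 3 in ideal form** (the old registered stub `stub_idealGap`, now DERIVED): the preimage
of the Γ-ideal lies in the Γ-subgroup. [cite: KontsevichZagier2001, §4.1] -/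
theorem idealGap :
    ∀ c : FormalRep, toFormalPeriod c ∈ Ideal.span (toFormalPeriod '' gammaHodgePairs) → c ∈ sector :=
  idealGap_of_spectator stub_spectatorStability

/-! ## Composition -/

/-- **The crux from the registered stubs**: kernel form (`completeModGammaSector_iff_ker_le`), then
for a value-zero `c` take the anchored transport data (`stub_anchoredTransportData`), run the
transport engine (`stub_fuchsianTransport`, fed with the seams `stub_piCancellationModGamma`,
`stub_torsionFreeModGamma`) to get `⟦c⟧ ∈ JΓ`, and return to the subgroup by `idealGap` (= `stub_spectatorStability` + glue).
[cite: KontsevichZagier2001, §1.2 Conjecture 1] -/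
theorem CompleteModGammaSector_of : CompleteModGammaSector := by
  refine completeModGammaSector_iff_ker_le.mpr fun c hc => ?_
  have hc0 : eval c = 0 := hc
  obtain ⟨F₀, F₀', F₁', K₁₀, K₁₀', K₂₀, K₂₀', K₁₁, K₁₁', K₂₁, K₂₁', m, a, b, p, q, hm, hq, hF₀,
    hF₀', h₁, h₂, hW⟩ := stub_anchoredTransportData c hc0
  exact idealGap c (stub_fuchsianTransport F₀ F₀' (toFormalPeriod c) F₁' K₁₀ K₁₀' K₂₀ K₂₀'
    K₁₁ K₁₁' K₂₁ K₂₁' m a b p q stub_piCancellationModGamma stub_torsionFreeModGamma hm hq hF₀ hF₀'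
    h₁ h₂ hW)

/-! ## Sorry-free bookkeeping: the Γ-ideal evaluates to zero, the sector maps into it -/

/-- The Γ-ideal lies in the kernel of evaluation (every Γ-pair has value `0`). [folklore] -/
theorem span_gammaHodgePairs_le_ker_evalP :
    Ideal.span (toFormalPeriod '' gammaHodgePairs) ≤ RingHom.ker evalP := by
  refine Ideal.span_le.mpr ?_
  rintro p ⟨d, hd, rfl⟩
  rw [SetLike.mem_coe, RingHom.mem_ker, evalP_toFormalPeriod]
  exact closure_gammaHodgePairs_le_ker_eval (AddSubgroup.subset_closure hd)

/-- The Γ-subgroup `sector` maps into the Γ-ideal of `P`. [folklore] -/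
theorem toFormalPeriod_mem_span_of_mem_sector {c : FormalRep} (hc : c ∈ sector) :
    toFormalPeriod c ∈ Ideal.span (toFormalPeriod '' gammaHodgePairs) := by
  have hle : sector ≤ ((Ideal.span (toFormalPeriod '' gammaHodgePairs)).toAddSubgroup).comap
      toFormalPeriod.toAddMonoidHom := by
    refine sup_le ?_ ((AddSubgroup.closure_le _).mpr ?_)
    · intro d hd
      rw [AddSubgroup.mem_comap]
      show toFormalPeriod d ∈ Ideal.span (toFormalPeriod '' gammaHodgePairs)
      rw [toFormalPeriod_eq_zero_of_mem hd]
      exact Submodule.zero_mem _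
    · intro d hd
      rw [SetLike.mem_coe, AddSubgroup.mem_comap]
      show toFormalPeriod d ∈ Ideal.span (toFormalPeriod '' gammaHodgePairs)
      exact Ideal.subset_span ⟨d, hd, rfl⟩
  have := hle hc
  rw [AddSubgroup.mem_comap] at this
  exact this

/-! ## Sorry-free bookkeeping: every open stub is crux-implied (no kill short of `¬` summit) -/

/-- Under the crux, every value-zero class lies in the Γ-ideal. [folklore] -/
theorem toFormalPeriod_mem_span_of_crux (h : CompleteModGammaSector) {c : FormalRep} (hc : eval c = 0) :
    toFormalPeriod c ∈ Ideal.span (toFormalPeriod '' gammaHodgePairs) :=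
  toFormalPeriod_mem_span_of_mem_sector (completeModGammaSector_iff_ker_le.mp h hc)

/-- Seam 2 is crux-implied. [folklore] -/
theorem piCancellationModGamma_of_crux (h : CompleteModGammaSector) :
    ∀ x : FormalPeriodRing, toFormalPeriod (of piRep) * x ∈ Ideal.span (toFormalPeriod '' gammaHodgePairs) →
      x ∈ Ideal.span (toFormalPeriod '' gammaHodgePairs) := by
  intro x hx
  obtain ⟨c, rfl⟩ := toFormalPeriod_surjective x
  refine toFormalPeriod_mem_span_of_crux h ?_
  have h0 : evalP (toFormalPeriod (of piRep) * toFormalPeriod c) = 0 := span_gammaHodgePairs_le_ker_evalP hx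
  rw [map_mul, evalP_toFormalPeriod_of, piRep_value, evalP_toFormalPeriod, mul_eq_zero] at h0
  exact h0.resolve_left Real.pi_ne_zero

/-- Seam 3 is crux-implied. [folklore] -/
theorem idealGap_of_crux (h : CompleteModGammaSector) :
    ∀ c : FormalRep, toFormalPeriod c ∈ Ideal.span (toFormalPeriod '' gammaHodgePairs) → c ∈ sector := by
  intro c hc
  refine completeModGammaSector_iff_ker_le.mp h ?_
  have h0 : evalP (toFormalPeriod c) = 0 := span_gammaHodgePairs_le_ker_evalP hc
  rwa [evalP_toFormalPeriod] at h0

/-- Seam 3 in generator form is crux-implied. [folklore] -/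
theorem spectatorStability_of_crux (h : CompleteModGammaSector) :
    ∀ (n : ℕ) (σ : IntegralRep n) (d : FormalRep), d ∈ gammaHodgePairs → of σ * d ∈ sector :=
  spectatorStability_of_idealGap (idealGap_of_crux h)

/-- The residual is crux-implied (degenerate constant family: anchor `⟦c⟧` itself, basis
`K = (⟦π⟧, 1)`). [folklore] -/
theorem anchoredTransportData_of_crux (h : CompleteModGammaSector) :
    ∀ c : FormalRep, eval c = 0 →
      ∃ (F₀ F₀' F₁' K₁₀ K₁₀' K₂₀ K₂₀' K₁₁ K₁₁' K₂₁ K₂₁' : FormalPeriodRing) (m a b p q : ℤ),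
        m ≠ 0 ∧ q ≠ 0 ∧
        F₀ ∈ Ideal.span (toFormalPeriod '' gammaHodgePairs) ∧
        F₀' ∈ Ideal.span (toFormalPeriod '' gammaHodgePairs) ∧
        m • (toFormalPeriod c * K₂₁' - F₁' * K₂₁) - a • (F₀ * K₂₀' - F₀' * K₂₀) = 0 ∧
        m • (toFormalPeriod c * K₁₁' - F₁' * K₁₁) - b • (F₀ * K₁₀' - F₀' * K₁₀) = 0 ∧
        p • (K₁₁ * K₂₁' - K₂₁ * K₁₁') - q • toFormalPeriod (of piRep) ∈
          Ideal.span (toFormalPeriod '' gammaHodgePairs) := by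
  intro c hc
  refine ⟨toFormalPeriod c, 0, 0, 1, 1, 1, 1, toFormalPeriod (of piRep), 1, 0, 1, 1, 1, 1, 1, 1,
    one_ne_zero, one_ne_zero, toFormalPeriod_mem_span_of_crux h hc, Submodule.zero_mem _, ?_, ?_, ?_⟩
  · simp
  · simp
  · simp

end Summit.KontsevichZagierPeriods.KontsevichZagierPeriods.CompleteModGammaSectorLine
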